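import Literature.Barriers.RiemannHypothesis.TuranPartialSumsMontgomeryProofs
import Literature.Barriers.RiemannHypothesis.TuranPartialSumsMVHolds
import HarnessLib

/-!
# `montgomery1983_supZeroRe` holds: the two-sided `ψ_N = 1 + (4/π − 1 − o(1)) log log N/log N`

Barrier catalogue `Literature/Barriers/RiemannHypothesis/` (D-0021). Proofs only (no definitions, no named
facts), companion of `TuranPartialSums.lean`: the discharge of the named fact
`Literature.Barriers.RiemannHypothesis.montgomery1983_supZeroRe` (Platt–Trudgian 2016, §1: "Montgomery
showed that for all `N` sufficiently large, `ψ_N = 1 + (4/π − 1 − o(1)) log log N/log N`, where the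
constant `4/π − 1` is best possible"), assembling two files of the tree:

* `TuranPartialSumsMontgomeryProofs.lean` — `Montgomery1983_theorem_holds`, Montgomery 1983, Theorem
  (p. 497): for `0 < c < 4/π − 1` and `N > N₀(c)`, `ζ_N` has zeros in `σ > 1 + c log log N/log N`
  (the LOWER half);
* `TuranPartialSumsMVHolds.lean` — `montgomery1983_supZeroRe_of_montgomeryThm`: the two-sided fact from
  Montgomery's theorem alone, the UPPER half being Montgomery–Vaughan 2001, Theorem 4
  (`MontgomeryVaughan2001_zeroFree_holds`).

## References

* [PlattTrudgian2016] D. J. Platt, T. S. Trudgian, *Zeroes of partial sums of the zeta-function*, LMS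
  J. Comput. Math. 19 (2016), 37–41, §1.
* [Montgomery1983] H. L. Montgomery, *Zeros of approximations to the zeta function*, in: Studies in
  Pure Mathematics to the memory of Paul Turán, Birkhäuser 1983, 497–506: §1, Theorem (p. 497).
* [MontgomeryVaughan2001] H. L. Montgomery, R. C. Vaughan, *Mean values of multiplicative functions*,
  Period. Math. Hungar. 43 (2001), 199–214: Theorem 4.
-/

namespace Literature.Barriers.RiemannHypothesis

/-- **`montgomery1983_supZeroRe` holds**: for every `ε > 0` and all large `N`, the section
`ζ_N(s) = Σ_{n ≤ N} n^{−s}` has a zero with `Re s ≥ 1 + (4/π − 1 − ε) log log N/log N`, and no zero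
with `Re s > 1 + (4/π − 1 + ε) log log N/log N` — discharge of the named fact
`Literature.Barriers.RiemannHypothesis.montgomery1983_supZeroRe`, from Montgomery's theorem
(`Montgomery1983_theorem_holds`) and Montgomery–Vaughan's Theorem 4 (through
`montgomery1983_supZeroRe_of_montgomeryThm`). [cite: PlattTrudgian2016, §1]
[cite: Montgomery1983, §1 Theorem (p. 497)] [cite: MontgomeryVaughan2001, Theorem 4] -/
theorem montgomery1983_supZeroRe_holds : montgomery1983_supZeroRe :=
  montgomery1983_supZeroRe_of_montgomeryThm Montgomery1983_theorem_holds

end Literature.Barriers.RiemannHypothesis
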